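import Literature.Analysis.FluidPDE.PassiveVectorTensorDistortedDuality
import Literature.Analysis.FunctionSpaces.TorusMollifiedFields
import Literature.Analysis.FunctionSpaces.TorusSpaceTimeConvolution
import Literature.Analysis.FunctionSpaces.TorusMollifierEstimates
import Literature.Analysis.FunctionSpaces.TorusAnalyticSeminorm
import Literature.Analysis.FluidPDE.PassiveScalarPairingTools
import Literature.Analysis.FunctionSpaces.TimeMollification
import HarnessLib

/-!
# The flat weak formulation for time-Lipschitz tests of FINITE space-regularity order
# (joint continuity of orders `≤ 2` only), by space mollification

The landed theorem `Torus.IsWeakTensorPassiveVectorOn.weak_eq_of_isLipschitzSpaceTimeTest`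
(`PassiveVectorTensorLipschitzTest.lean`) extends the weak formulation of the flat class
`Torus.IsWeakTensorPassiveVectorOn A T 𝔸 b w₀ w` (passive vector / tensor-viscosity equation
`∂ₜw + (b·∇)w = A (w·∇)b + ∇·(𝔸∇w)` on `(0,T) × 𝕋^d`) from `C_c^∞((-∞,T) × 𝕋^d)` tests to tests of the
class `Torus.IsLipschitzSpaceTimeTest T Ψ`: smooth slices, Lipschitz in `t`, and ALL iterated space
derivatives `∂^l Ψ` jointly continuous in `(t, y)`.  The last requirement (used there for the uniform
convergence of the Fourier truncations) is inconvenient for tests manufactured by composing a smooth field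
with a flow map or a frame of finite smoothness.  This file removes it: joint continuity of `Ψ`, `∇Ψ`, `∇²Ψ`
suffices (`IsWeakTensorPassiveVectorOn.weak_eq_of_lipschitz_of_continuous₂`, §5).

## The argument (space mollification; Majda–Bertozzi, Lemma 3.5)

Mollify in space only: `Φ^ε(t) := vecMollify ε (Φ t)` (componentwise convolution with the smooth bump
`Torus.kernel ε` of unit mass supported in `B(0, ε)`, `0 < ε ≤ 1/4`).
* §1  Elementary facts: sup bound `‖Φ^ε‖ ≤ (card d)‖Φ‖_∞`, all iterated derivatives fall on the kernel
  `∂^l(θ ⋆ k) = θ ⋆ ∂^l k`, joint continuity of `(t,y) ↦ (Φ(t) ⋆ K)(y)` for jointly continuous `Φ` and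
  continuous `K` (dominated convergence), uniform approximation `‖Φ^ε − Φ‖ ≤ (card d) η` on
  `K × 𝕋^d`, `K` compact, for `ε` small (uniform continuity).
* §2  `Φ^ε` IS an admissible `IsLipschitzSpaceTimeTest` whenever `Φ` is jointly continuous, Lipschitz in
  `t` and supported in `t < T'` — with NO space regularity of `Φ` (all derivatives fall on the kernel);
  it is divergence free when the slices of `Φ` are; `∂ⱼ(Φ^ε) = (∂ⱼΦ)^ε`, `∂ᵢ∂ⱼ(Φ^ε) = (∂ᵢ∂ⱼΦ)^ε` for smooth
  slices.
* §3  The time derivative: by Rademacher and Fubini, for a.e. `t ∈ (0,T)` the map `τ ↦ Φ τ z` is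
  differentiable at `t` for a.e. `z`, and then `∂ₜ(Φ^ε)(t, y) = (∂ₜΦ(t))^ε(y)` for every `y`
  (differentiation under the integral sign, Lipschitz domination).
* §4  Limit tools (squeeze; uniform convergence along a null sequence of radii; bounds of finite
  families; joint continuity of `𝓛_𝔸^* Φ`).
* §5  The theorem: apply the landed identity to `Φ^{εₙ}`, `εₙ = 1/(n+4)`, split the slice integrals
  (product integrability of the four pieces from the distorted-class bookkeeping with `G ≡ 1`,
  `toDistorted_one`), dominate (`(card d)·L·∫‖w‖ + … `), and pass to the limit: the time-derivative term by
  `L²` convergence `‖(∂ₜΦ(t))^ε − ∂ₜΦ(t)‖₂ → 0` against `w(t) ∈ L²` (Cauchy–Schwarz), the transport /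
  viscous / stretching terms by the uniform convergence of `∇^{≤2}Φ^ε` on `[0,T] × 𝕋^d`, the datum by
  uniform convergence of `Φ^ε(0)`.

No new definitions, no named facts; standard axioms.

## References
* A. J. Majda, A. L. Bertozzi, *Vorticity and Incompressible Flow*, CUP 2002, Lemma 3.5 (properties of
  mollifiers: sup bound (3.36), commutation with derivatives (3.37), uniform convergence on compacts).
* R. J. DiPerna, P.-L. Lions, Invent. Math. 98 (1989), §II.1 (12)–(14) (weak formulation, Lipschitz tests
  by regularisation).
* H. Brezis, *Functional Analysis, Sobolev Spaces and PDE*, Springer 2011, Cor. 8.10 (Lipschitz =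
  `W^{1,∞}`, a.e. differentiability).
* J. C. Robinson, J. L. Rodrigo, W. Sadowski, *The three-dimensional Navier–Stokes equations*, CUP 2016,
  Thm. 4.4 Step 4 (passage to the limit in the weak formulation).
* U. Frisch, *Turbulence*, CUP 1995, §9.6.3 eq. (9.57) (the tensor-viscosity operator).
-/

noncomputable section

open MeasureTheory Set Filter Function TopologicalSpace Metric
open scoped ENNReal NNReal InnerProductSpace Topology Convolution

namespace Literature.Analysis.FluidPDE

namespace Torus

open Literature.Analysis.FunctionSpaces.Torus (kernel vecMollify vecMollify_apply isSmooth_kernel continuous_kernel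
  kernel_nonneg integral_kernel support_kernel_subset isSmooth_vecMollify)

variable {d : Type*} [Fintype d] [DecidableEq d]

/-! ## §1 Space mollification of time-dependent fields: bounds, smoothness, joint continuity -/

section Mollify

/-- Sup bound of the vector mollification: `‖u^ε(x)‖ ≤ (card d) · M` when `‖u‖ ≤ M` (componentwise
sup bound; Majda–Bertozzi (3.36)). [cite: MajdaBertozziCUP2002, Lemma 3.5 (i) eq. (3.36)] -/
theorem norm_vecMollify_le {u : UnitAddTorus d → EuclideanSpace ℝ d} (hum : AEStronglyMeasurable u volume)
    {M : ℝ} (hu : ∀ z, ‖u z‖ ≤ M) {ε : ℝ} (hε : 0 < ε) (hε' : ε ≤ 1 / 4) (x : UnitAddTorus d) :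
    ‖vecMollify ε u x‖ ≤ Fintype.card d * M := by
  have hcomp : ∀ i, |vecMollify ε u x i| ≤ M := fun i => by
    rw [vecMollify_apply]
    refine abs_convolution_le_of_forall_abs_le ?_ (fun z => ?_)
      (kernel_nonneg hε.le) (integral_kernel hε hε') x
    · exact (EuclideanSpace.proj i : EuclideanSpace ℝ d →L[ℝ] ℝ).continuous.comp_aestronglyMeasurable hum
    · exact (FunctionSpaces.Torus.abs_apply_le_norm (u z) i).trans (hu z)
  calc ‖vecMollify ε u x‖ ≤ ∑ i, |vecMollify ε u x i| := FunctionSpaces.Torus.norm_le_sum_abs_coord _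
    _ ≤ ∑ _i : d, M := Finset.sum_le_sum fun i _ => hcomp i
    _ = Fintype.card d * M := by rw [Finset.sum_const, Finset.card_univ, nsmul_eq_mul]

/-- **Iterated derivatives of a mollification fall on the kernel**: `∂^l (θ ⋆ k) = θ ⋆ ∂^l k` for
`θ ∈ L¹`, `k` smooth. [cite: MajdaBertozziCUP2002, Lemma 3.5 (ii) eq. (3.37)] -/
theorem iterPartialDeriv_convolution {θ : UnitAddTorus d → ℝ} (hθ : Integrable θ volume)
    {k : UnitAddTorus d → ℝ} (hk : FunctionSpaces.Torus.IsSmooth k) :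
    ∀ l : List d, FunctionSpaces.Torus.iterPartialDeriv l (θ ⋆ k) = θ ⋆ FunctionSpaces.Torus.iterPartialDeriv l k
  | [] => rfl
  | i :: l => by
    rw [FunctionSpaces.Torus.iterPartialDeriv_cons, FunctionSpaces.Torus.iterPartialDeriv_cons,
      iterPartialDeriv_convolution hθ hk l]
    funext x
    exact FunctionSpaces.Torus.partialDeriv_convolution hθ (hk.iterPartialDeriv l) i x

/-- Components of the iterated derivatives of the vector mollification:
`(∂^l u^ε)(y)_i = (u_i ⋆ ∂^l k_ε)(y)`. [cite: MajdaBertozziCUP2002, Lemma 3.5 (ii) eq. (3.37)] -/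
theorem iterPartialDeriv_vecMollify_apply {u : UnitAddTorus d → EuclideanSpace ℝ d} (hu : Integrable u volume)
    {ε : ℝ} (hε : 0 < ε) (hε' : ε ≤ 1 / 4) (l : List d) (y : UnitAddTorus d) (i : d) :
    FunctionSpaces.Torus.iterPartialDeriv l (vecMollify ε u) y i =
      ((fun z => u z i) ⋆ FunctionSpaces.Torus.iterPartialDeriv l (kernel ε)) y := by
  have h1 := congrFun (FunctionSpaces.Torus.iterPartialDeriv_apply_coord (isSmooth_vecMollify hu hε hε') i l) y
  simp only at h1
  rw [← h1, show (fun y => vecMollify ε u y i) = ((fun z => u z i) ⋆ kernel ε) from funext fun y => rfl,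
    iterPartialDeriv_convolution (hu.eval_piLp i) (isSmooth_kernel hε hε') l]

omit [DecidableEq d] in
/-- **Joint continuity of slice-wise mollifications**: if `(t, y) ↦ Φ t y` is jointly continuous
(scalar) and `K` is a continuous kernel, then `(t, y) ↦ (Φ t ⋆ K)(y)` is jointly continuous
(dominated convergence, locally in `t`). [cite: MajdaBertozziCUP2002, Lemma 3.5 (i)] -/
theorem continuous_uncurry_convolution_slice {Φ : ℝ → UnitAddTorus d → ℝ} (hΦ : Continuous (uncurry Φ))
    {K : UnitAddTorus d → ℝ} (hK : Continuous K) :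
    Continuous (uncurry fun t y => (Φ t ⋆ K) y) := by
  obtain ⟨CK, hCK⟩ := FunctionSpaces.Torus.exists_forall_norm_le_of_continuous hK
  refine continuous_iff_continuousAt.2 fun p₀ => ?_
  -- a bound of `Φ` on `[t₀ - 1, t₀ + 1] × 𝕋^d`
  obtain ⟨B, hB⟩ := (isCompact_Icc.prod isCompact_univ).exists_bound_of_continuousOn
    (s := Icc (p₀.1 - 1) (p₀.1 + 1) ×ˢ (univ : Set (UnitAddTorus d))) hΦ.continuousOn
  have e : (uncurry fun t y => (Φ t ⋆ K) y) = fun p : ℝ × UnitAddTorus d => ∫ z, Φ p.1 z * K (p.2 - z) := by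
    funext p; simp only [uncurry, convolution_lsmul, smul_eq_mul]
  rw [e]
  refine continuousAt_of_dominated (bound := fun _ => B * CK) ?_ ?_ (integrable_const _) ?_
  · exact Eventually.of_forall fun p => ((hΦ.comp (continuous_const.prodMk continuous_id)).mul
      (hK.comp (continuous_const.sub continuous_id))).aestronglyMeasurable
  · have hnb : ∀ᶠ p : ℝ × UnitAddTorus d in 𝓝 p₀, p.1 ∈ Icc (p₀.1 - 1) (p₀.1 + 1) :=
      (continuous_fst.tendsto p₀).eventually (Icc_mem_nhds (by linarith) (by linarith))
    filter_upwards [hnb] with p hp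
    refine ae_of_all _ fun z => ?_
    rw [norm_mul]
    exact mul_le_mul (hB (p.1, z) ⟨hp, mem_univ _⟩) (hCK _) (norm_nonneg _)
      ((norm_nonneg _).trans (hB (p.1, z) ⟨hp, mem_univ _⟩))
  · exact ae_of_all _ fun z => ((hΦ.comp (continuous_fst.prodMk continuous_const)).mul
      (hK.comp (continuous_snd.sub continuous_const))).continuousAt

/-- **Uniform approximation by mollification, uniformly on compact time sets**: for a jointly
continuous vector field `g : ℝ → 𝕋^d → ℝ^d` and a compact `K ⊆ ℝ`, given `η > 0` there is `δ > 0`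
with `‖g^ε(t, y) − g(t, y)‖ ≤ η` for all `0 < ε ≤ min δ (1/4)`, `t ∈ K`, `y` (uniform continuity on
`K × 𝕋^d` and `dist_convolution_le`; Majda–Bertozzi, Lemma 3.5 (i)). [cite: MajdaBertozziCUP2002, Lemma 3.5 (i)] -/
theorem exists_forall_norm_vecMollify_sub_le {g : ℝ → UnitAddTorus d → EuclideanSpace ℝ d}
    (hg : Continuous (uncurry g)) {K : Set ℝ} (hK : IsCompact K) {η : ℝ} (hη : 0 < η) :
    ∃ δ > 0, ∀ ε, 0 < ε → ε ≤ 1 / 4 → ε ≤ δ → ∀ t ∈ K, ∀ y,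
      ‖vecMollify ε (g t) y - g t y‖ ≤ Fintype.card d * η := by
  have huc := (hK.prod isCompact_univ).uniformContinuousOn_of_continuous
    (s := K ×ˢ (univ : Set (UnitAddTorus d))) hg.continuousOn
  obtain ⟨δ, hδ, hmod⟩ := Metric.uniformContinuousOn_iff.1 huc η hη
  refine ⟨δ, hδ, fun ε hε hε' hεδ t ht y => ?_⟩
  have hcomp : ∀ i, |vecMollify ε (g t) y i - g t y i| ≤ η := by
    intro i
    rw [vecMollify_apply, FunctionSpaces.Torus.convolution_comm_real]
    have h1 := dist_convolution_le (μ := (volume : Measure (UnitAddTorus d))) (f := kernel ε)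
      (g := fun z => g t z i) (x₀ := y) (z₀ := g t y i) hη.le
      ((support_kernel_subset hε).trans (ball_subset_ball hεδ)) (kernel_nonneg hε.le) (integral_kernel hε hε')
      (((EuclideanSpace.proj i : EuclideanSpace ℝ d →L[ℝ] ℝ).continuous.comp
        (hg.comp (continuous_const.prodMk continuous_id))).aestronglyMeasurable) ?_
    · rwa [Real.dist_eq] at h1
    · intro z hz
      have h2 := hmod (t, z) ⟨ht, mem_univ _⟩ (t, y) ⟨ht, mem_univ _⟩ (by
        rw [Prod.dist_eq, dist_self, max_eq_right dist_nonneg]; exact mem_ball.1 hz)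
      simp only [uncurry, dist_eq_norm] at h2
      rw [Real.dist_eq, ← PiLp.sub_apply]
      exact (FunctionSpaces.Torus.abs_apply_le_norm _ i).trans h2.le
  calc ‖vecMollify ε (g t) y - g t y‖ ≤ ∑ i, |(vecMollify ε (g t) y - g t y) i| :=
        FunctionSpaces.Torus.norm_le_sum_abs_coord _
    _ ≤ ∑ _i : d, η := Finset.sum_le_sum fun i _ => by
        rw [PiLp.sub_apply]; exact hcomp i
    _ = Fintype.card d * η := by rw [Finset.sum_const, Finset.card_univ, nsmul_eq_mul]

end Mollify

/-! ## §2 Space-mollified time-Lipschitz fields are admissible time-Lipschitz space-smooth tests -/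

section Admissible

variable {T : ℝ} {Φ : ℝ → UnitAddTorus d → EuclideanSpace ℝ d}

omit [DecidableEq d] in
/-- A jointly continuous field has integrable slices. [folklore] -/
private theorem integrable_slice_lm (hc : Continuous (uncurry Φ)) (t : ℝ) : Integrable (Φ t) volume :=
  (hc.comp (continuous_const.prodMk continuous_id)).integrable_unitAddTorus

/-- **Joint continuity of all iterated space derivatives of the mollified field** `(t,y) ↦ ∂^l Φ^ε(t)(y)`
(the derivatives fall on the kernel; joint continuity of `Φ` suffices).  [cite: MajdaBertozziCUP2002, Lemma 3.5 (i)–(ii)] -/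
theorem continuous_uncurry_iterPartialDeriv_vecMollify (hc : Continuous (uncurry Φ)) {ε : ℝ} (hε : 0 < ε)
    (hε' : ε ≤ 1 / 4) (l : List d) :
    Continuous (uncurry fun t y => FunctionSpaces.Torus.iterPartialDeriv l (vecMollify ε (Φ t)) y) := by
  have e : (uncurry fun t y => FunctionSpaces.Torus.iterPartialDeriv l (vecMollify ε (Φ t)) y) =
      (WithLp.toLp 2) ∘ fun p : ℝ × UnitAddTorus d => fun i =>
        ((fun z => Φ p.1 z i) ⋆ FunctionSpaces.Torus.iterPartialDeriv l (kernel ε)) p.2 := by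
    funext p
    simp only [uncurry, comp_apply]
    refine PiLp.ext fun i => ?_
    rw [PiLp.toLp_apply]
    exact iterPartialDeriv_vecMollify_apply (integrable_slice_lm hc p.1) hε hε' l p.2 i
  rw [e]
  refine (PiLp.continuous_toLp 2 _).comp (continuous_pi fun i => ?_)
  exact continuous_uncurry_convolution_slice (Φ := fun t z => Φ t z i)
    (by exact (EuclideanSpace.proj i : EuclideanSpace ℝ d →L[ℝ] ℝ).continuous.comp hc)
    ((isSmooth_kernel hε hε').iterPartialDeriv l).continuous

omit [DecidableEq d] in
/-- `vecMollify` is subtractive in the field (integrable fields): linearity of `𝒥_ε`.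
[cite: MajdaBertozziCUP2002, Lemma 3.5 eq. (3.35)] -/
theorem vecMollify_sub {u v : UnitAddTorus d → EuclideanSpace ℝ d} (hu : Integrable u volume)
    (hv : Integrable v volume) {ε : ℝ} (hε : 0 < ε) (hε' : ε ≤ 1 / 4) (x : UnitAddTorus d) :
    vecMollify ε (u - v) x = vecMollify ε u x - vecMollify ε v x := by
  refine PiLp.ext fun i => ?_
  rw [PiLp.sub_apply, vecMollify_apply, vecMollify_apply, vecMollify_apply]
  have e : (fun y => (u - v) y i) = (fun y => u y i) - fun y => v y i := by
    funext y; simp only [Pi.sub_apply, PiLp.sub_apply]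
  rw [e, FunctionSpaces.Torus.sub_convolution (hu.eval_piLp i) (hv.eval_piLp i) (continuous_kernel hε hε'),
    Pi.sub_apply]

/-- **Space-mollified time-Lipschitz fields are admissible tests of the Lipschitz class.**  For a
jointly continuous `Φ`, Lipschitz in `t` on `[0,T]` uniformly in `y`, vanishing for `t ≥ T'` (`T' < T`),
the field `t ↦ Φ(t)^ε` (`0 < ε ≤ 1/4`) is an `IsLipschitzSpaceTimeTest T`: smooth slices, ALL iterated
space derivatives jointly continuous (they fall on the kernel), Lipschitz in `t` with constant
`(card d)·L`, same support in time.  No space regularity of `Φ` is needed.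
[cite: MajdaBertozziCUP2002, Lemma 3.5 (i)–(ii)] [cite: DiPernaLions1989, §II.1 (13)–(14)] -/
theorem isLipschitzSpaceTimeTest_vecMollify (hc : Continuous (uncurry Φ))
    (hL : ∃ L : ℝ, 0 ≤ L ∧ ∀ t ∈ Icc 0 T, ∀ s ∈ Icc 0 T, ∀ y, ‖Φ t y - Φ s y‖ ≤ L * |t - s|)
    (hT' : ∃ T' < T, ∀ t, T' ≤ t → Φ t = 0) {ε : ℝ} (hε : 0 < ε) (hε' : ε ≤ 1 / 4) :
    IsLipschitzSpaceTimeTest T (fun t => vecMollify ε (Φ t)) where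
  isSmooth_slice t := isSmooth_vecMollify (integrable_slice_lm hc t) hε hε'
  continuous_uncurry := by
    simpa using continuous_uncurry_iterPartialDeriv_vecMollify hc hε hε' []
  continuous_uncurry_partialDeriv j := by
    simpa using continuous_uncurry_iterPartialDeriv_vecMollify hc hε hε' [j]
  continuous_uncurry_partialDeriv₂ i j := by
    simpa using continuous_uncurry_iterPartialDeriv_vecMollify hc hε hε' [i, j]
  continuous_uncurry_iterPartialDeriv l := continuous_uncurry_iterPartialDeriv_vecMollify hc hε hε' l
  lipschitz := by
    obtain ⟨L, hL0, hL⟩ := hL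
    refine ⟨Fintype.card d * L, by positivity, fun t ht s hs y => ?_⟩
    rw [← vecMollify_sub (integrable_slice_lm hc t) (integrable_slice_lm hc s) hε hε']
    have h := norm_vecMollify_le (u := Φ t - Φ s) ((integrable_slice_lm hc t).sub (integrable_slice_lm hc s)).1
      (M := L * |t - s|) (fun z => by simpa only [Pi.sub_apply] using hL t ht s hs z) hε hε' y
    simpa only [mul_assoc] using h
  eventually_zero := by
    obtain ⟨T', hT'T, hzero⟩ := hT'
    refine ⟨T', hT'T, fun t ht => ?_⟩
    funext y
    rw [hzero t ht, FunctionSpaces.Torus.vecMollify_zero]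

/-- The mollified field is divergence free when the slices are smooth and divergence free
(`Torus.IsDivFree.vecConv`). [cite: MajdaBertozziCUP2002, Lemma 3.5 (ii) eq. (3.37)] -/
theorem isDivFree_vecMollify {u : UnitAddTorus d → EuclideanSpace ℝ d} (hu : FunctionSpaces.Torus.IsSmooth u)
    (hdiv : FunctionSpaces.Torus.IsDivFree u) {ε : ℝ} (hε : 0 < ε) (hε' : ε ≤ 1 / 4) :
    FunctionSpaces.Torus.IsDivFree (vecMollify ε u) :=
  hdiv.vecConv hu (isSmooth_kernel hε hε')

/-- **Space derivatives commute with mollification for smooth slices**: `∂ⱼ(u^ε) = (∂ⱼu)^ε`.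
[cite: MajdaBertozziCUP2002, Lemma 3.5 (ii) eq. (3.37)] -/
theorem partialDeriv_vecMollify {u : UnitAddTorus d → EuclideanSpace ℝ d} (hu : FunctionSpaces.Torus.IsSmooth u)
    {ε : ℝ} (hε : 0 < ε) (hε' : ε ≤ 1 / 4) (j : d) (y : UnitAddTorus d) :
    FunctionSpaces.Torus.partialDeriv j (vecMollify ε u) y = vecMollify ε (FunctionSpaces.Torus.partialDeriv j u) y := by
  have hui : Integrable u volume := hu.continuous.integrable_unitAddTorus
  refine PiLp.ext fun i => ?_
  rw [← FunctionSpaces.Torus.partialDeriv_apply_coord ((isSmooth_vecMollify hui hε hε').isContDiff (by simp)),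
    show (fun y => vecMollify ε u y i) = ((fun z => u z i) ⋆ kernel ε) from funext fun y => rfl,
    FunctionSpaces.Torus.partialDeriv_convolution (hui.eval_piLp i) (isSmooth_kernel hε hε'),
    FunctionSpaces.Torus.convolution_partialDeriv_right (hu.apply i) (isSmooth_kernel hε hε'), vecMollify_apply]
  congr 1
  funext z
  exact FunctionSpaces.Torus.partialDeriv_apply_coord (hu.isContDiff (by simp)) j z i

/-- Second space derivatives commute with mollification for smooth slices: `∂ᵢ∂ⱼ(u^ε) = (∂ᵢ∂ⱼu)^ε`.
[cite: MajdaBertozziCUP2002, Lemma 3.5 (ii) eq. (3.37)] -/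
theorem partialDeriv₂_vecMollify {u : UnitAddTorus d → EuclideanSpace ℝ d} (hu : FunctionSpaces.Torus.IsSmooth u)
    {ε : ℝ} (hε : 0 < ε) (hε' : ε ≤ 1 / 4) (i j : d) (y : UnitAddTorus d) :
    FunctionSpaces.Torus.partialDeriv i (FunctionSpaces.Torus.partialDeriv j (vecMollify ε u)) y =
      vecMollify ε (FunctionSpaces.Torus.partialDeriv i (FunctionSpaces.Torus.partialDeriv j u)) y := by
  rw [show FunctionSpaces.Torus.partialDeriv j (vecMollify ε u) = vecMollify ε (FunctionSpaces.Torus.partialDeriv j u)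
    from funext (partialDeriv_vecMollify hu hε hε' j), partialDeriv_vecMollify (hu.partialDeriv j) hε hε' i y]

end Admissible

/-! ## §3 The time derivative of the mollified field -/

section TimeDeriv

variable {T : ℝ} {Φ : ℝ → UnitAddTorus d → EuclideanSpace ℝ d}

omit [DecidableEq d] in
/-- **Rademacher + Fubini**: for a jointly continuous field that is Lipschitz in `t` on `[0,T]`
uniformly in `y`, for a.e. `t ∈ (0,T)` the map `τ ↦ Φ τ y` is differentiable at `t` for a.e. `y`.
[cite: Brezis2011, Cor. 8.10 (W^{1,∞} = Lip)] -/
theorem ae_ae_differentiableAt_of_lipschitz (hc : Continuous (uncurry Φ))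
    (hL : ∃ L : ℝ, 0 ≤ L ∧ ∀ t ∈ Icc 0 T, ∀ s ∈ Icc 0 T, ∀ y, ‖Φ t y - Φ s y‖ ≤ L * |t - s|) :
    ∀ᵐ t ∂(volume.restrict (Ioo 0 T)), ∀ᵐ y ∂(volume : Measure (UnitAddTorus d)),
      DifferentiableAt ℝ (fun τ => Φ τ y) t := by
  obtain ⟨L, hL0, hL⟩ := hL
  have hcont : Continuous (uncurry fun (x : UnitAddTorus d) (τ : ℝ) => Φ τ x) := hc.comp continuous_swap
  have hS : MeasurableSet {p : UnitAddTorus d × ℝ | DifferentiableAt ℝ (fun τ => Φ τ p.1) p.2} :=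
    measurableSet_of_differentiableAt_with_param (𝕜 := ℝ) (f := fun (x : UnitAddTorus d) (τ : ℝ) => Φ τ x) hcont
  have hx : ∀ x, ∀ᵐ t ∂(volume.restrict (Ioo 0 T)), DifferentiableAt ℝ (fun τ => Φ τ x) t := by
    intro x
    have hlip : LipschitzOnWith (Real.toNNReal L) (fun τ => Φ τ x) (Icc 0 T) :=
      LipschitzOnWith.of_dist_le' fun a ha b' hb => by
        rw [dist_eq_norm, Real.dist_eq]; exact hL a ha b' hb x
    have h1 := hlip.ae_differentiableWithinAt_of_mem (μ := volume)
    filter_upwards [ae_restrict_mem measurableSet_Ioo, ae_restrict_of_ae (s := Ioo 0 T) h1] with t ht h1t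
    exact (h1t (Ioo_subset_Icc_self ht)).differentiableAt (Icc_mem_nhds ht.1 ht.2)
  have hprod : ∀ᵐ z ∂((volume : Measure (UnitAddTorus d)).prod (volume.restrict (Ioo 0 T))),
      z ∈ {p : UnitAddTorus d × ℝ | DifferentiableAt ℝ (fun τ => Φ τ p.1) p.2} :=
    (Measure.ae_prod_mem_iff_ae_ae_mem hS).2 (ae_of_all _ hx)
  have hswap := (Measure.measurePreserving_swap (μ := volume.restrict (Ioo 0 T))
    (ν := (volume : Measure (UnitAddTorus d)))).quasiMeasurePreserving.ae hprod
  exact Measure.ae_ae_of_ae_prod hswap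

omit [DecidableEq d] in
/-- The time derivative of a jointly continuous field is measurable in `y` (Mathlib's
`measurable_deriv_with_param`). [cite: Brezis2011, Cor. 8.10 (W^{1,∞} = Lip)] -/
theorem measurable_timeDeriv_slice (hc : Continuous (uncurry Φ)) (t : ℝ) :
    Measurable fun y => FunctionSpaces.Torus.timeDeriv Φ t y := by
  have hm := measurable_deriv_with_param (𝕜 := ℝ) (f := fun (x : UnitAddTorus d) (τ : ℝ) => Φ τ x)
    (hc.comp continuous_swap)
  exact hm.comp (measurable_id.prodMk measurable_const)

omit [DecidableEq d] in
/-- The time derivative of a time-Lipschitz field is bounded by the Lipschitz constant on `(0,T)`.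
[cite: Brezis2011, Cor. 8.10 (W^{1,∞} = Lip)] -/
theorem norm_timeDeriv_le_of_lipschitz {L : ℝ} (hL0 : 0 ≤ L)
    (hL : ∀ t ∈ Icc 0 T, ∀ s ∈ Icc 0 T, ∀ y, ‖Φ t y - Φ s y‖ ≤ L * |t - s|) {t : ℝ} (ht : t ∈ Ioo 0 T)
    (y : UnitAddTorus d) : ‖FunctionSpaces.Torus.timeDeriv Φ t y‖ ≤ L :=
  norm_deriv_le_of_lipschitzOn hL0 (fun a ha b' hb => hL a ha b' hb y) ht

omit [DecidableEq d] in
/-- **The time derivative of the mollified field is the mollified time derivative**, for a.e. `t`: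
`∂ₜ(Φ^ε)(t, y) = (∂ₜΦ(t))^ε(y)` for every `y`, at every `t ∈ (0,T)` at which `τ ↦ Φ τ z` is
differentiable for a.e. `z` (differentiation under the integral sign for a Lipschitz integrand).
[cite: Brezis2011, Cor. 8.10 (W^{1,∞} = Lip)] [cite: MajdaBertozziCUP2002, Lemma 3.5 (ii)] -/
theorem hasDerivAt_vecMollify_of_ae_differentiableAt (hc : Continuous (uncurry Φ))
    (hL : ∃ L : ℝ, 0 ≤ L ∧ ∀ t ∈ Icc 0 T, ∀ s ∈ Icc 0 T, ∀ y, ‖Φ t y - Φ s y‖ ≤ L * |t - s|)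
    {ε : ℝ} (hε : 0 < ε) (hε' : ε ≤ 1 / 4) {t : ℝ} (ht : t ∈ Ioo 0 T)
    (hD : ∀ᵐ z ∂(volume : Measure (UnitAddTorus d)), DifferentiableAt ℝ (fun τ => Φ τ z) t) (y : UnitAddTorus d) :
    HasDerivAt (fun τ => vecMollify ε (Φ τ) y) (vecMollify ε (FunctionSpaces.Torus.timeDeriv Φ t) y) t := by
  obtain ⟨L, hL0, hL⟩ := hL
  obtain ⟨CK, hCK⟩ := FunctionSpaces.Torus.exists_forall_norm_le_of_continuous (continuous_kernel (d := d) hε hε')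
  -- componentwise
  have hcomp : ∀ i, HasDerivAt (fun τ => ((fun z => Φ τ z i) ⋆ kernel ε) y)
      (((fun z => FunctionSpaces.Torus.timeDeriv Φ t z i) ⋆ kernel ε) y) t := by
    intro i
    set F : ℝ → UnitAddTorus d → ℝ := fun τ z => Φ τ z i * kernel ε (y - z) with hFdef
    set F' : UnitAddTorus d → ℝ := fun z => FunctionSpaces.Torus.timeDeriv Φ t z i * kernel ε (y - z) with hF'def
    have hΦi : ∀ τ, Continuous fun z => Φ τ z i := fun τ =>
      (EuclideanSpace.proj i : EuclideanSpace ℝ d →L[ℝ] ℝ).continuous.comp (hc.comp (continuous_const.prodMk continuous_id))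
    have hky : Continuous fun z => kernel ε (y - z) := (continuous_kernel hε hε').comp (continuous_const.sub continuous_id)
    have hF_meas : ∀ᶠ τ in 𝓝 t, AEStronglyMeasurable (F τ) volume :=
      Eventually.of_forall fun τ => ((hΦi τ).mul hky).aestronglyMeasurable
    have hF_int : Integrable (F t) volume := ((hΦi t).mul hky).integrable_unitAddTorus
    have hF'_meas : AEStronglyMeasurable F' volume :=
      (((measurable_pi_apply i).comp ((WithLp.measurable_ofLp (p := 2) (X := d → ℝ)).comp
        (measurable_timeDeriv_slice hc t))).mul hky.measurable).aestronglyMeasurable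
    have h_lip : ∀ᵐ z ∂(volume : Measure (UnitAddTorus d)), LipschitzOnWith (Real.nnabs (L * CK)) (F · z) (Ioo 0 T) := by
      refine ae_of_all _ fun z => LipschitzOnWith.of_dist_le_mul fun a ha b' hb => ?_
      simp only [hFdef]
      rw [dist_eq_norm, ← sub_mul, norm_mul, Real.coe_nnabs, abs_of_nonneg (mul_nonneg hL0
        ((norm_nonneg _).trans (hCK 0))), Real.dist_eq]
      have h1 : ‖Φ a z i - Φ b' z i‖ ≤ L * |a - b'| := by
        rw [← PiLp.sub_apply, Real.norm_eq_abs]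
        exact (FunctionSpaces.Torus.abs_apply_le_norm _ i).trans (hL a (Ioo_subset_Icc_self ha) b' (Ioo_subset_Icc_self hb) z)
      calc ‖Φ a z i - Φ b' z i‖ * ‖kernel ε (y - z)‖ ≤ (L * |a - b'|) * CK :=
            mul_le_mul h1 (hCK _) (norm_nonneg _) (by positivity)
        _ = L * CK * |a - b'| := by ring
    have h_diff : ∀ᵐ z ∂(volume : Measure (UnitAddTorus d)), HasDerivAt (F · z) (F' z) t := by
      filter_upwards [hD] with z hz
      have h1 : HasDerivAt (fun τ => Φ τ z i) (FunctionSpaces.Torus.timeDeriv Φ t z i) t := by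
        have h2 := hz.hasDerivAt
        have h3 := (PiLp.continuousLinearEquiv 2 ℝ (fun _ : d => ℝ)).hasFDerivAt.comp_hasDerivAt t h2
        have h4 := hasDerivAt_pi.1 h3 i
        simpa [FunctionSpaces.Torus.timeDeriv] using h4
      exact h1.mul_const _
    have key := hasDerivAt_integral_of_dominated_loc_of_lip (Ioo_mem_nhds ht.1 ht.2) hF_meas hF_int hF'_meas h_lip
      (integrable_const _) h_diff
    have e1 : (fun τ => ((fun z => Φ τ z i) ⋆ kernel ε) y) = fun τ => ∫ z, F τ z :=
      funext fun τ => by rw [convolution_lsmul]; rfl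
    have e2 : ((fun z => FunctionSpaces.Torus.timeDeriv Φ t z i) ⋆ kernel ε) y = ∫ z, F' z := by
      rw [convolution_lsmul]; rfl
    rw [e1, e2]
    exact key.2
  -- assemble the vector-valued derivative
  have hpi : HasDerivAt (fun τ => fun i => ((fun z => Φ τ z i) ⋆ kernel ε) y)
      (fun i => ((fun z => FunctionSpaces.Torus.timeDeriv Φ t z i) ⋆ kernel ε) y) t :=
    hasDerivAt_pi.2 hcomp
  have h := (PiLp.continuousLinearEquiv 2 ℝ (fun _ : d => ℝ)).symm.hasFDerivAt.comp_hasDerivAt t hpi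
  convert h using 1 <;> rfl

omit [DecidableEq d] in
/-- For a.e. `t ∈ (0,T)`: `timeDeriv (Φ^ε) t y = (timeDeriv Φ t)^ε y` for every `y`.
[cite: Brezis2011, Cor. 8.10 (W^{1,∞} = Lip)] -/
theorem ae_timeDeriv_vecMollify_eq (hc : Continuous (uncurry Φ))
    (hL : ∃ L : ℝ, 0 ≤ L ∧ ∀ t ∈ Icc 0 T, ∀ s ∈ Icc 0 T, ∀ y, ‖Φ t y - Φ s y‖ ≤ L * |t - s|)
    {ε : ℝ} (hε : 0 < ε) (hε' : ε ≤ 1 / 4) :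
    ∀ᵐ t ∂(volume.restrict (Ioo 0 T)), ∀ y,
      FunctionSpaces.Torus.timeDeriv (fun τ => vecMollify ε (Φ τ)) t y =
        vecMollify ε (FunctionSpaces.Torus.timeDeriv Φ t) y := by
  filter_upwards [ae_ae_differentiableAt_of_lipschitz hc hL, ae_restrict_mem measurableSet_Ioo] with t hD ht y
  exact (hasDerivAt_vecMollify_of_ae_differentiableAt hc hL hε hε' ht hD y).deriv

end TimeDeriv

/-! ## §4 Tools for the limit `ε → 0` -/

section LimitTools

variable {T : ℝ} {Φ : ℝ → UnitAddTorus d → EuclideanSpace ℝ d}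

omit [Fintype d] [DecidableEq d] in
/-- Squeeze: if for every `η > 0` eventually `|aₙ − x| ≤ C η`, then `aₙ → x`. [folklore] -/
private theorem tendsto_of_forall_eventually_abs_sub_le {a : ℕ → ℝ} {x C : ℝ} (hC : 0 ≤ C)
    (h : ∀ η : ℝ, 0 < η → ∀ᶠ n in atTop, |a n - x| ≤ C * η) : Tendsto a atTop (𝓝 x) := by
  rw [Metric.tendsto_atTop]
  intro e he
  have hη : 0 < e / (C + 1) := div_pos he (by linarith)
  obtain ⟨N, hN⟩ := eventually_atTop.1 (h _ hη)
  refine ⟨N, fun n hn => ?_⟩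
  rw [Real.dist_eq]
  calc |a n - x| ≤ C * (e / (C + 1)) := hN n hn
    _ < e := by
        rw [mul_div_assoc']
        rw [div_lt_iff₀ (by linarith)]
        nlinarith

/-- **Uniform convergence along a null sequence of radii** (eventually form of
`exists_forall_norm_vecMollify_sub_le`). [cite: MajdaBertozziCUP2002, Lemma 3.5 (i)] -/
theorem eventually_forall_norm_vecMollify_sub_le {g : ℝ → UnitAddTorus d → EuclideanSpace ℝ d}
    (hg : Continuous (uncurry g)) {K : Set ℝ} (hK : IsCompact K) {ε : ℕ → ℝ} (hε : ∀ n, 0 < ε n)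
    (hε' : ∀ n, ε n ≤ 1 / 4) (hε0 : Tendsto ε atTop (𝓝 0)) {η : ℝ} (hη : 0 < η) :
    ∀ᶠ n in atTop, ∀ t ∈ K, ∀ y, ‖vecMollify (ε n) (g t) y - g t y‖ ≤ Fintype.card d * η := by
  obtain ⟨δ, hδ, hU⟩ := exists_forall_norm_vecMollify_sub_le hg hK hη
  filter_upwards [(tendsto_order.1 hε0).2 δ hδ] with n hn t ht y
  exact hU (ε n) (hε n) (hε' n) hn.le t ht y

omit [DecidableEq d] in
/-- Uniform bound of a jointly continuous field on `[0,T] × 𝕋^d`, for a finite family. [folklore] -/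
private theorem exists_bound_family_lm {ι : Type*} [Fintype ι] {g : ι → ℝ → UnitAddTorus d → EuclideanSpace ℝ d}
    (hg : ∀ j, Continuous (uncurry (g j))) (T : ℝ) :
    ∃ M : ℝ, 0 ≤ M ∧ ∀ j, ∀ t ∈ Icc 0 T, ∀ y, ‖g j t y‖ ≤ M := by
  have hb : ∀ j, ∃ B, ∀ p ∈ Icc 0 T ×ˢ (univ : Set (UnitAddTorus d)), ‖uncurry (g j) p‖ ≤ B := fun j =>
    (isCompact_Icc.prod isCompact_univ).exists_bound_of_continuousOn (hg j).continuousOn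
  choose B hB using hb
  refine ⟨∑ j, |B j|, Finset.sum_nonneg fun j _ => abs_nonneg _, fun j t ht y => ?_⟩
  calc ‖g j t y‖ ≤ B j := hB j (t, y) ⟨ht, mem_univ _⟩
    _ ≤ |B j| := le_abs_self _
    _ ≤ ∑ j, |B j| := Finset.single_le_sum (fun j _ => abs_nonneg (B j)) (Finset.mem_univ j)

/-- `(t, x) ↦ 𝓛_𝔸^* Φ(t)(x)` is jointly continuous when the second space derivatives of `Φ` are.
[cite: Frisch1995Turbulence, §9.6.3 eq. (9.57) p. 233] -/
theorem continuous_uncurry_viscAdj_of_partialDeriv₂ (𝔸 : Visc4 d)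
    (hc2 : ∀ i j, Continuous (uncurry fun t y =>
      FunctionSpaces.Torus.partialDeriv i (FunctionSpaces.Torus.partialDeriv j (Φ t)) y)) :
    Continuous (uncurry fun t x => viscAdj 𝔸 (Φ t) x) := by
  have e : (uncurry fun t x => viscAdj 𝔸 (Φ t) x) = fun p : ℝ × UnitAddTorus d =>
      ∑ j, (∑ i, ∑ a, ∑ b, 𝔸 i a j b *
        (FunctionSpaces.Torus.partialDeriv a (FunctionSpaces.Torus.partialDeriv b (Φ p.1)) p.2) i) •
          EuclideanSpace.single j (1 : ℝ) := by
    funext p; rfl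
  rw [e]
  refine continuous_finsetSum _ fun j _ => ?_
  have hsc : Continuous fun p : ℝ × UnitAddTorus d => ∑ i, ∑ a, ∑ b, 𝔸 i a j b *
      (FunctionSpaces.Torus.partialDeriv a (FunctionSpaces.Torus.partialDeriv b (Φ p.1)) p.2) i :=
    continuous_finsetSum _ fun i _ => continuous_finsetSum _ fun a _ => continuous_finsetSum _ fun b _ =>
      continuous_const.mul ((EuclideanSpace.proj i : EuclideanSpace ℝ d →L[ℝ] ℝ).continuous.comp (hc2 a b))
  exact hsc.smul continuous_const

end LimitTools

/-! ## §5 The flat weak formulation for time-Lipschitz tests with joint space regularity of order `≤ 2` -/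

section Main

namespace IsWeakTensorPassiveVectorOn

variable {A T : ℝ} {𝔸 : Visc4 d} {b w : ℝ → UnitAddTorus d → EuclideanSpace ℝ d}
  {w₀ : UnitAddTorus d → EuclideanSpace ℝ d} {Φ : ℝ → UnitAddTorus d → EuclideanSpace ℝ d}

omit [Fintype d] [DecidableEq d] in
/-- `1/(n+4) ∈ (0, 1/4]` and `→ 0`. [folklore] -/
private theorem radii_lm : (∀ n : ℕ, 0 < 1 / ((n : ℝ) + 4)) ∧ (∀ n : ℕ, 1 / ((n : ℝ) + 4) ≤ 1 / 4) ∧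
    Tendsto (fun n : ℕ => 1 / ((n : ℝ) + 4)) atTop (𝓝 0) := by
  refine ⟨fun n => by positivity, fun n => ?_, ?_⟩
  · have h4 : (4 : ℝ) ≤ (n : ℝ) + 4 := by linarith [(n.cast_nonneg : (0 : ℝ) ≤ n)]
    exact one_div_le_one_div_of_le (by norm_num) h4
  · refine squeeze_zero (fun n => by positivity) (fun n => ?_) tendsto_one_div_add_atTop_nhds_zero_nat
    have h1 : (n : ℝ) + 1 ≤ (n : ℝ) + 4 := by linarith
    exact one_div_le_one_div_of_le (by positivity) h1

set_option maxHeartbeats 1600000 in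
/-- **THE FLAT WEAK FORMULATION FOR TIME-LIPSCHITZ TESTS OF FINITE ORDER.**  Let `w` be a weak
solution of the flat class `IsWeakTensorPassiveVectorOn A T 𝔸 b w₀ w` with `w₀ ∈ L²`, and let
`Φ : ℝ → 𝕋^d → ℝ^d` have smooth divergence-free slices, be Lipschitz in `t` on `[0,T]` uniformly in `y`,
vanish for `t ≥ T'` (`T' < T`), with `Φ`, `∇Φ`, `∇²Φ` JOINTLY CONTINUOUS — no joint continuity of higher
derivatives (the only difference with `Torus.IsLipschitzSpaceTimeTest`).  Then the weak identity holds: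
`∫₀ᵀ∫ (⟪w, ∂ₜΦ + (b·∇)Φ + 𝓛_𝔸^*Φ⟫ + A⟪b, (w·∇)Φ⟫) + ∫⟪w₀, Φ(0)⟫ = 0`.
Proof: the space mollifications `Φ^ε` are admissible Lipschitz tests (§2), so the identity holds for them
(`weak_eq_of_isLipschitzSpaceTimeTest`); as `ε → 0`, `∇^{≤2}Φ^ε = (∇^{≤2}Φ)^ε → ∇^{≤2}Φ` uniformly on
`[0,T] × 𝕋^d`, `∂ₜ(Φ^ε) = (∂ₜΦ)^ε → ∂ₜΦ` in `L²` for a.e. `t` against `w(t) ∈ L²`, and dominated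
convergence in `t`.  [cite: DiPernaLions1989, §II.1 (13)–(14)] [cite: MajdaBertozziCUP2002, Lemma 3.5]
[cite: RobinsonRodrigoSadowski2016, Thm. 4.4 Step 4] -/
theorem weak_eq_of_lipschitz_of_continuous₂ (h : IsWeakTensorPassiveVectorOn A T 𝔸 b w₀ w)
    (hw₀ : MemLp w₀ 2 volume) (hs : ∀ t, FunctionSpaces.Torus.IsSmooth (Φ t)) (hc : Continuous (uncurry Φ))
    (hc1 : ∀ j, Continuous (uncurry fun t y => FunctionSpaces.Torus.partialDeriv j (Φ t) y))
    (hc2 : ∀ i j, Continuous (uncurry fun t y =>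
      FunctionSpaces.Torus.partialDeriv i (FunctionSpaces.Torus.partialDeriv j (Φ t)) y))
    (hL : ∃ L : ℝ, 0 ≤ L ∧ ∀ t ∈ Icc 0 T, ∀ s ∈ Icc 0 T, ∀ y, ‖Φ t y - Φ s y‖ ≤ L * |t - s|)
    (hT' : ∃ T' < T, ∀ t, T' ≤ t → Φ t = 0) (hdiv : ∀ t, FunctionSpaces.Torus.IsDivFree (Φ t)) :
    (∫ t in Ioo 0 T, ∫ x, (⟪w t x, FunctionSpaces.Torus.timeDeriv Φ t x +
          FunctionSpaces.Torus.convect (b t) (Φ t) x + viscAdj 𝔸 (Φ t) x⟫_ℝ +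
        A * ⟪b t x, FunctionSpaces.Torus.convect (w t) (Φ t) x⟫_ℝ)) +
      ∫ x, ⟪w₀ x, Φ 0 x⟫_ℝ = 0 := by
  obtain ⟨L, hL0, hLb⟩ := hL
  have hD1 := h.toDistorted_one hw₀
  have hw₀i : Integrable w₀ volume := hw₀.integrable one_le_two
  obtain ⟨hεpos, hεle, hε0⟩ := radii_lm
  set εn : ℕ → ℝ := fun n => 1 / ((n : ℝ) + 4) with hεn
  -- the mollified tests
  set Ψn : ℕ → ℝ → UnitAddTorus d → EuclideanSpace ℝ d := fun n t => vecMollify (εn n) (Φ t) with hΨn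
  have hadm : ∀ n, IsLipschitzSpaceTimeTest T (Ψn n) := fun n =>
    isLipschitzSpaceTimeTest_vecMollify hc ⟨L, hL0, hLb⟩ hT' (hεpos n) (hεle n)
  have hdivn : ∀ n t, FunctionSpaces.Torus.IsDivFree (Ψn n t) := fun n t =>
    isDivFree_vecMollify (hs t) (hdiv t) (hεpos n) (hεle n)
  have hI : ∀ n, (∫ t in Ioo 0 T, ∫ x, (⟪w t x, FunctionSpaces.Torus.timeDeriv (Ψn n) t x +
          FunctionSpaces.Torus.convect (b t) (Ψn n t) x + viscAdj 𝔸 (Ψn n t) x⟫_ℝ +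
        A * ⟪b t x, FunctionSpaces.Torus.convect (w t) (Ψn n t) x⟫_ℝ)) +
      ∫ x, ⟪w₀ x, Ψn n 0 x⟫_ℝ = 0 := fun n => h.weak_eq_of_isLipschitzSpaceTimeTest hw₀ (hadm n) (hdivn n)
  -- derivative identities and bounds
  have hd1 : ∀ n t j y, FunctionSpaces.Torus.partialDeriv j (Ψn n t) y =
      vecMollify (εn n) (FunctionSpaces.Torus.partialDeriv j (Φ t)) y :=
    fun n t j y => partialDeriv_vecMollify (hs t) (hεpos n) (hεle n) j y
  have hd2 : ∀ n t i j y, FunctionSpaces.Torus.partialDeriv i (FunctionSpaces.Torus.partialDeriv j (Ψn n t)) y =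
      vecMollify (εn n) (FunctionSpaces.Torus.partialDeriv i (FunctionSpaces.Torus.partialDeriv j (Φ t))) y :=
    fun n t i j y => partialDeriv₂_vecMollify (hs t) (hεpos n) (hεle n) i j y
  obtain ⟨M₁, hM₁0, hM₁⟩ := exists_bound_family_lm hc1 T
  obtain ⟨M₂, hM₂0, hM₂⟩ := exists_bound_family_lm (ι := d × d)
    (g := fun p t y => FunctionSpaces.Torus.partialDeriv p.1 (FunctionSpaces.Torus.partialDeriv p.2 (Φ t)) y)
    (fun p => hc2 p.1 p.2) T
  have hdP : ∀ n, ∀ t ∈ Icc 0 T, ∀ j x, ‖FunctionSpaces.Torus.partialDeriv j (Ψn n t) x‖ ≤ Fintype.card d * M₁ := by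
    intro n t ht j x
    rw [hd1]
    exact norm_vecMollify_le ((hs t).partialDeriv j).continuous.aestronglyMeasurable (hM₁ j t ht) (hεpos n) (hεle n) x
  have hdP₂ : ∀ n, ∀ t ∈ Icc 0 T, ∀ i j x, ‖FunctionSpaces.Torus.partialDeriv i
      (FunctionSpaces.Torus.partialDeriv j (Ψn n t)) x‖ ≤ Fintype.card d * M₂ := by
    intro n t ht i j x
    rw [hd2]
    exact norm_vecMollify_le (((hs t).partialDeriv j).partialDeriv i).continuous.aestronglyMeasurable
      (hM₂ (i, j) t ht) (hεpos n) (hεle n) x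
  -- the time derivative of the mollified tests, a.e. in `t`
  have htd : ∀ᵐ t ∂(volume.restrict (Ioo 0 T)), ∀ n y, FunctionSpaces.Torus.timeDeriv (Ψn n) t y =
      vecMollify (εn n) (FunctionSpaces.Torus.timeDeriv Φ t) y :=
    ae_all_iff.2 fun n => ae_timeDeriv_vecMollify_eq hc ⟨L, hL0, hLb⟩ (hεpos n) (hεle n)
  have htdb : ∀ t ∈ Ioo 0 T, ∀ y, ‖FunctionSpaces.Torus.timeDeriv Φ t y‖ ≤ L := fun t ht y =>
    norm_timeDeriv_le_of_lipschitz hL0 hLb ht y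
  have htdm : ∀ t, AEStronglyMeasurable (FunctionSpaces.Torus.timeDeriv Φ t) volume := fun t =>
    (measurable_timeDeriv_slice hc t).aestronglyMeasurable
  -- product integrability of the four pieces, for the mollified tests and for `Φ`
  have h1c : ∀ c a, FunctionSpaces.Torus.IsContDiff 1 (fun _ : UnitAddTorus d => (1 : Matrix d d ℝ) c a) :=
    fun c a => FunctionSpaces.Torus.isContDiff_const _
  have hPt : ∀ n, Integrable (fun p : ℝ × UnitAddTorus d => ⟪w p.1 p.2, FunctionSpaces.Torus.timeDeriv (Ψn n) p.1 p.2⟫_ℝ)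
      ((volume.restrict (Ioo 0 T)).prod volume) := fun n =>
    hD1.integrable_inner_timeDeriv (hadm n).continuous_uncurry (hadm n).lipschitz
  have hPc : ∀ n, Integrable (fun p : ℝ × UnitAddTorus d => ⟪w p.1 p.2, FunctionSpaces.Torus.convect (b p.1) (Ψn n p.1) p.2⟫_ℝ)
      ((volume.restrict (Ioo 0 T)).prod volume) := fun n =>
    hD1.integrable_inner_convect (fun t => ((hadm n).isSmooth_slice t).isContDiff (by simp))
      (hadm n).continuous_uncurry_partialDeriv
  have hPv : ∀ n, Integrable (fun p : ℝ × UnitAddTorus d => ⟪w p.1 p.2, viscAdj 𝔸 (Ψn n p.1) p.2⟫_ℝ)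
      ((volume.restrict (Ioo 0 T)).prod volume) := fun n =>
    hD1.integrable_inner_of_continuous (continuous_uncurry_viscAdj_of_partialDeriv₂ 𝔸 (hadm n).continuous_uncurry_partialDeriv₂)
  have hPs : ∀ n, Integrable (fun p : ℝ × UnitAddTorus d => ⟪b p.1 p.2, FunctionSpaces.Torus.convect (w p.1) (Ψn n p.1) p.2⟫_ℝ)
      ((volume.restrict (Ioo 0 T)).prod volume) := fun n =>
    hD1.integrable_inner_carrier_convect (fun t => ((hadm n).isSmooth_slice t).isContDiff (by simp))
      (hadm n).continuous_uncurry_partialDeriv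
  have hQt : Integrable (fun p : ℝ × UnitAddTorus d => ⟪w p.1 p.2, FunctionSpaces.Torus.timeDeriv Φ p.1 p.2⟫_ℝ)
      ((volume.restrict (Ioo 0 T)).prod volume) := hD1.integrable_inner_timeDeriv hc ⟨L, hL0, hLb⟩
  have hQc : Integrable (fun p : ℝ × UnitAddTorus d => ⟪w p.1 p.2, FunctionSpaces.Torus.convect (b p.1) (Φ p.1) p.2⟫_ℝ)
      ((volume.restrict (Ioo 0 T)).prod volume) :=
    hD1.integrable_inner_convect (fun t => (hs t).isContDiff (by simp)) hc1
  have hQv : Integrable (fun p : ℝ × UnitAddTorus d => ⟪w p.1 p.2, viscAdj 𝔸 (Φ p.1) p.2⟫_ℝ)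
      ((volume.restrict (Ioo 0 T)).prod volume) :=
    hD1.integrable_inner_of_continuous (continuous_uncurry_viscAdj_of_partialDeriv₂ 𝔸 hc2)
  have hQs : Integrable (fun p : ℝ × UnitAddTorus d => ⟪b p.1 p.2, FunctionSpaces.Torus.convect (w p.1) (Φ p.1) p.2⟫_ℝ)
      ((volume.restrict (Ioo 0 T)).prod volume) :=
    hD1.integrable_inner_carrier_convect (fun t => (hs t).isContDiff (by simp)) hc1
  -- integrable functions of `t`
  have hIbw : Integrable (fun t => ∫ x, ‖b t x‖ * ‖w t x‖) (volume.restrict (Ioo 0 T)) :=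
    h.integrable_norm_carrier_mul_norm.integral_prod_left
  have hIw : Integrable (fun t => ∫ x, ‖w t x‖) (volume.restrict (Ioo 0 T)) :=
    h.integrable_uncurry.norm.integral_prod_left
  have hbw_slice : ∀ᵐ t ∂(volume.restrict (Ioo 0 T)), Integrable (fun x => ‖b t x‖ * ‖w t x‖) volume :=
    h.integrable_norm_carrier_mul_norm.prod_right_ae
  -- slice integrability of the pieces, a.e. in `t`, all `n`
  have hsl : ∀ᵐ t ∂(volume.restrict (Ioo 0 T)), ∀ n,
      Integrable (fun x => ⟪w t x, FunctionSpaces.Torus.timeDeriv (Ψn n) t x⟫_ℝ) volume ∧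
      Integrable (fun x => ⟪w t x, FunctionSpaces.Torus.convect (b t) (Ψn n t) x⟫_ℝ) volume ∧
      Integrable (fun x => ⟪w t x, viscAdj 𝔸 (Ψn n t) x⟫_ℝ) volume ∧
      Integrable (fun x => ⟪b t x, FunctionSpaces.Torus.convect (w t) (Ψn n t) x⟫_ℝ) volume := by
    refine ae_all_iff.2 fun n => ?_
    filter_upwards [(hPt n).prod_right_ae, (hPc n).prod_right_ae, (hPv n).prod_right_ae, (hPs n).prod_right_ae]
      with t h1 h2 h3 h4
    exact ⟨h1, h2, h3, h4⟩
  have hslΦ : ∀ᵐ t ∂(volume.restrict (Ioo 0 T)),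
      Integrable (fun x => ⟪w t x, FunctionSpaces.Torus.timeDeriv Φ t x⟫_ℝ) volume ∧
      Integrable (fun x => ⟪w t x, FunctionSpaces.Torus.convect (b t) (Φ t) x⟫_ℝ) volume ∧
      Integrable (fun x => ⟪w t x, viscAdj 𝔸 (Φ t) x⟫_ℝ) volume ∧
      Integrable (fun x => ⟪b t x, FunctionSpaces.Torus.convect (w t) (Φ t) x⟫_ℝ) volume := by
    filter_upwards [hQt.prod_right_ae, hQc.prod_right_ae, hQv.prod_right_ae, hQs.prod_right_ae] with t h1 h2 h3 h4
    exact ⟨h1, h2, h3, h4⟩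
  -- splitting of the slice integrals
  have hsplit : ∀ {Ψ' : ℝ → UnitAddTorus d → EuclideanSpace ℝ d} {t : ℝ},
      Integrable (fun x => ⟪w t x, FunctionSpaces.Torus.timeDeriv Ψ' t x⟫_ℝ) volume →
      Integrable (fun x => ⟪w t x, FunctionSpaces.Torus.convect (b t) (Ψ' t) x⟫_ℝ) volume →
      Integrable (fun x => ⟪w t x, viscAdj 𝔸 (Ψ' t) x⟫_ℝ) volume →
      Integrable (fun x => ⟪b t x, FunctionSpaces.Torus.convect (w t) (Ψ' t) x⟫_ℝ) volume →
      (∫ x, (⟪w t x, FunctionSpaces.Torus.timeDeriv Ψ' t x + FunctionSpaces.Torus.convect (b t) (Ψ' t) x +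
          viscAdj 𝔸 (Ψ' t) x⟫_ℝ + A * ⟪b t x, FunctionSpaces.Torus.convect (w t) (Ψ' t) x⟫_ℝ)) =
        (∫ x, ⟪w t x, FunctionSpaces.Torus.timeDeriv Ψ' t x⟫_ℝ) +
          ((∫ x, ⟪w t x, FunctionSpaces.Torus.convect (b t) (Ψ' t) x⟫_ℝ) +
            ((∫ x, ⟪w t x, viscAdj 𝔸 (Ψ' t) x⟫_ℝ) +
              A * ∫ x, ⟪b t x, FunctionSpaces.Torus.convect (w t) (Ψ' t) x⟫_ℝ)) := by
    intro Ψ' t i1 i2 i3 i4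
    have i4' := i4.const_mul A
    have e : ∀ x, ⟪w t x, FunctionSpaces.Torus.timeDeriv Ψ' t x + FunctionSpaces.Torus.convect (b t) (Ψ' t) x +
          viscAdj 𝔸 (Ψ' t) x⟫_ℝ + A * ⟪b t x, FunctionSpaces.Torus.convect (w t) (Ψ' t) x⟫_ℝ =
        ⟪w t x, FunctionSpaces.Torus.timeDeriv Ψ' t x⟫_ℝ + (⟪w t x, FunctionSpaces.Torus.convect (b t) (Ψ' t) x⟫_ℝ +
          (⟪w t x, viscAdj 𝔸 (Ψ' t) x⟫_ℝ + A * ⟪b t x, FunctionSpaces.Torus.convect (w t) (Ψ' t) x⟫_ℝ)) := by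
      intro x; rw [inner_add_right, inner_add_right]; ring
    simp_rw [e]
    have i34 : Integrable (fun x => ⟪w t x, viscAdj 𝔸 (Ψ' t) x⟫_ℝ +
        A * ⟪b t x, FunctionSpaces.Torus.convect (w t) (Ψ' t) x⟫_ℝ) volume := i3.add i4'
    have i234 : Integrable (fun x => ⟪w t x, FunctionSpaces.Torus.convect (b t) (Ψ' t) x⟫_ℝ +
        (⟪w t x, viscAdj 𝔸 (Ψ' t) x⟫_ℝ + A * ⟪b t x, FunctionSpaces.Torus.convect (w t) (Ψ' t) x⟫_ℝ)) volume :=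
      i2.add i34
    rw [integral_add i1 i234, integral_add i2 i34, integral_add i3 i4', MeasureTheory.integral_const_mul]
  -- the slice functionals
  set GN : ℕ → ℝ → ℝ := fun n t =>
    (∫ x, ⟪w t x, FunctionSpaces.Torus.timeDeriv (Ψn n) t x⟫_ℝ) +
      ((∫ x, ⟪w t x, FunctionSpaces.Torus.convect (b t) (Ψn n t) x⟫_ℝ) +
        ((∫ x, ⟪w t x, viscAdj 𝔸 (Ψn n t) x⟫_ℝ) +
          A * ∫ x, ⟪b t x, FunctionSpaces.Torus.convect (w t) (Ψn n t) x⟫_ℝ)) with hGN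
  set G : ℝ → ℝ := fun t =>
    (∫ x, ⟪w t x, FunctionSpaces.Torus.timeDeriv Φ t x⟫_ℝ) +
      ((∫ x, ⟪w t x, FunctionSpaces.Torus.convect (b t) (Φ t) x⟫_ℝ) +
        ((∫ x, ⟪w t x, viscAdj 𝔸 (Φ t) x⟫_ℝ) +
          A * ∫ x, ⟪b t x, FunctionSpaces.Torus.convect (w t) (Φ t) x⟫_ℝ)) with hGdef
  have hGN_meas : ∀ n, AEStronglyMeasurable (GN n) (volume.restrict (Ioo 0 T)) := fun n =>
    ((hPt n).integral_prod_left.aestronglyMeasurable.add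
      ((hPc n).integral_prod_left.aestronglyMeasurable.add
        ((hPv n).integral_prod_left.aestronglyMeasurable.add
          (((hPs n).integral_prod_left.aestronglyMeasurable).const_mul A))))
  -- the dominating function
  set K𝔸 : ℝ := ∑ l, ∑ i, ∑ a, ∑ b', |𝔸 i a l b'| with hK𝔸
  set bound : ℝ → ℝ := fun t => (Fintype.card d * L) * (∫ x, ‖w t x‖) +
    ((Fintype.card d * (Fintype.card d * M₁)) * (∫ x, ‖b t x‖ * ‖w t x‖) +
      ((K𝔸 * (Fintype.card d * M₂)) * (∫ x, ‖w t x‖) +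
        |A| * ((Fintype.card d * (Fintype.card d * M₁)) * (∫ x, ‖b t x‖ * ‖w t x‖)))) with hbound
  have hbound_int : Integrable bound (volume.restrict (Ioo 0 T)) :=
    (hIw.const_mul _).add ((hIbw.const_mul _).add ((hIw.const_mul _).add ((hIbw.const_mul _).const_mul _)))
  -- domination
  have h_le : ∀ n, ∀ᵐ t ∂(volume.restrict (Ioo 0 T)), ‖GN n t‖ ≤ bound t := by
    intro n
    filter_upwards [ae_restrict_mem measurableSet_Ioo, h.ae_integrable_slice, hbw_slice, htd] with t ht hτ hbwt htdt
    have htI : t ∈ Icc 0 T := Ioo_subset_Icc_self ht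
    have p1 : |∫ x, ⟪w t x, FunctionSpaces.Torus.timeDeriv (Ψn n) t x⟫_ℝ| ≤ (Fintype.card d * L) * ∫ x, ‖w t x‖ := by
      rw [← Real.norm_eq_abs]
      calc ‖∫ x, ⟪w t x, FunctionSpaces.Torus.timeDeriv (Ψn n) t x⟫_ℝ‖ ≤ ∫ x, ‖w t x‖ * (Fintype.card d * L) := by
            refine norm_integral_le_of_norm_le (hτ.1.norm.mul_const _) (ae_of_all _ fun x => ?_)
            rw [Real.norm_eq_abs, htdt n x]
            refine (abs_real_inner_le_norm _ _).trans (mul_le_mul_of_nonneg_left ?_ (norm_nonneg _))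
            exact norm_vecMollify_le (htdm t) (htdb t ht) (hεpos n) (hεle n) x
        _ = (Fintype.card d * L) * ∫ x, ‖w t x‖ := by rw [integral_mul_const, mul_comm]
    have p2 : |∫ x, ⟪w t x, FunctionSpaces.Torus.convect (b t) (Ψn n t) x⟫_ℝ| ≤
        (Fintype.card d * (Fintype.card d * M₁)) * ∫ x, ‖b t x‖ * ‖w t x‖ :=
      abs_integral_inner_convect_le_of_partialDeriv_le ((hadm n).isSmooth_slice t) (hdP n t htI) hbwt
    have p3 : |∫ x, ⟪w t x, viscAdj 𝔸 (Ψn n t) x⟫_ℝ| ≤ (K𝔸 * (Fintype.card d * M₂)) * ∫ x, ‖w t x‖ :=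
      abs_integral_inner_viscAdj_le_of_partialDeriv₂_le 𝔸 (hdP₂ n t htI) hτ.1
    have p4 : |∫ x, ⟪b t x, FunctionSpaces.Torus.convect (w t) (Ψn n t) x⟫_ℝ| ≤
        (Fintype.card d * (Fintype.card d * M₁)) * ∫ x, ‖b t x‖ * ‖w t x‖ := by
      have hwb : Integrable (fun x => ‖w t x‖ * ‖b t x‖) volume := hbwt.congr (ae_of_all _ fun x => mul_comm _ _)
      have h1 := abs_integral_inner_convect_le_of_partialDeriv_le (v := b t) (c := w t) ((hadm n).isSmooth_slice t)
        (hdP n t htI) hwb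
      have e : ∫ x, ‖w t x‖ * ‖b t x‖ = ∫ x, ‖b t x‖ * ‖w t x‖ := integral_congr_ae (ae_of_all _ fun x => mul_comm _ _)
      rw [e] at h1
      exact h1
    rw [hGN, hbound, Real.norm_eq_abs]
    dsimp only
    refine (abs_add_le _ _).trans (add_le_add p1 ((abs_add_le _ _).trans (add_le_add p2
      ((abs_add_le _ _).trans (add_le_add p3 ?_)))))
    rw [abs_mul]
    exact mul_le_mul_of_nonneg_left p4 (abs_nonneg _)
  have hK0 : 0 ≤ K𝔸 := by
    rw [hK𝔸]
    exact Finset.sum_nonneg fun _ _ => Finset.sum_nonneg fun _ _ => Finset.sum_nonneg fun _ _ =>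
      Finset.sum_nonneg fun _ _ => abs_nonneg _
  -- pointwise limits
  have h_lim : ∀ᵐ t ∂(volume.restrict (Ioo 0 T)), Tendsto (fun n => GN n t) atTop (𝓝 (G t)) := by
    filter_upwards [ae_restrict_mem measurableSet_Ioo, h.ae_integrable_slice, h.ae_memLp_two, hbw_slice, htd, hsl, hslΦ]
      with t ht hτ hwt hbwt htdt hslt hslΦt
    have htI : t ∈ Icc 0 T := Ioo_subset_Icc_self ht
    -- (1) the time-derivative term: `L²` convergence of the mollified `∂ₜΦ(t)` against `w(t) ∈ L²`
    have l1 : Tendsto (fun n => ∫ x, ⟪w t x, FunctionSpaces.Torus.timeDeriv (Ψn n) t x⟫_ℝ) atTop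
        (𝓝 (∫ x, ⟪w t x, FunctionSpaces.Torus.timeDeriv Φ t x⟫_ℝ)) := by
      set θ := FunctionSpaces.Torus.timeDeriv Φ t with hθ
      have hθ2 : MemLp θ 2 volume := MemLp.of_bound (htdm t) L (ae_of_all _ (htdb t ht))
      have hθi : Integrable θ volume := hθ2.integrable one_le_two
      have hconv := FunctionSpaces.Torus.tendsto_eLpNorm_vecMollify_sub hθ2 hεpos hεle hε0
      have hprod : Tendsto (fun n => eLpNorm (w t) 2 volume * eLpNorm (vecMollify (εn n) θ - θ) 2 volume) atTop (𝓝 0) := by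
        have := ENNReal.Tendsto.const_mul hconv (Or.inr hwt.2.ne)
        rwa [mul_zero] at this
      have i1 : Integrable (fun x => ⟪w t x, θ x⟫_ℝ) volume := hslΦt.1
      have hcs : ∀ n, ‖(∫ x, ⟪w t x, FunctionSpaces.Torus.timeDeriv (Ψn n) t x⟫_ℝ) - ∫ x, ⟪w t x, θ x⟫_ℝ‖ₑ ≤
          eLpNorm (w t) 2 volume * eLpNorm (vecMollify (εn n) θ - θ) 2 volume := by
        intro n
        rw [← integral_sub (hslt n).1 i1]
        have e : (fun x => ⟪w t x, FunctionSpaces.Torus.timeDeriv (Ψn n) t x⟫_ℝ - ⟪w t x, θ x⟫_ℝ) =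
            fun x => ⟪w t x, (vecMollify (εn n) θ - θ) x⟫_ℝ := by
          funext x; rw [htdt n x, Pi.sub_apply, inner_sub_right]
        rw [e]
        exact FunctionSpaces.enorm_integral_inner_le_eLpNorm_mul hwt.1
          ((isSmooth_vecMollify hθi (hεpos n) (hεle n)).continuous.aestronglyMeasurable.sub (htdm t))
      have hen : Tendsto (fun n => ‖(∫ x, ⟪w t x, FunctionSpaces.Torus.timeDeriv (Ψn n) t x⟫_ℝ) -
          ∫ x, ⟪w t x, θ x⟫_ℝ‖ₑ) atTop (𝓝 0) :=
        tendsto_of_tendsto_of_tendsto_of_le_of_le tendsto_const_nhds hprod (fun _ => bot_le) hcs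
      rw [tendsto_iff_norm_sub_tendsto_zero]
      have := (ENNReal.tendsto_toReal ENNReal.zero_ne_top).comp hen
      simpa only [comp_def, toReal_enorm, ENNReal.toReal_zero] using this
    -- uniform errors of the space derivatives along the radii
    have hU1 : ∀ η : ℝ, 0 < η → ∀ᶠ n in atTop, ∀ j x, ‖FunctionSpaces.Torus.partialDeriv j (Φ t) x -
        FunctionSpaces.Torus.partialDeriv j (Ψn n t) x‖ ≤ Fintype.card d * η := by
      intro η hη
      have hall : ∀ j, ∀ᶠ n in atTop, ∀ x, ‖FunctionSpaces.Torus.partialDeriv j (Φ t) x -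
          FunctionSpaces.Torus.partialDeriv j (Ψn n t) x‖ ≤ Fintype.card d * η := by
        intro j
        filter_upwards [eventually_forall_norm_vecMollify_sub_le (hc1 j) isCompact_Icc hεpos hεle hε0 hη] with n hn x
        rw [hd1, norm_sub_rev]
        exact hn t htI x
      filter_upwards [eventually_all.2 hall] with n hn j x using hn j x
    have hU2 : ∀ η : ℝ, 0 < η → ∀ᶠ n in atTop, ∀ i j x, ‖FunctionSpaces.Torus.partialDeriv i
        (FunctionSpaces.Torus.partialDeriv j (Φ t)) x - FunctionSpaces.Torus.partialDeriv i
        (FunctionSpaces.Torus.partialDeriv j (Ψn n t)) x‖ ≤ Fintype.card d * η := by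
      intro η hη
      have hall : ∀ p : d × d, ∀ᶠ n in atTop, ∀ x, ‖FunctionSpaces.Torus.partialDeriv p.1
          (FunctionSpaces.Torus.partialDeriv p.2 (Φ t)) x - FunctionSpaces.Torus.partialDeriv p.1
          (FunctionSpaces.Torus.partialDeriv p.2 (Ψn n t)) x‖ ≤ Fintype.card d * η := by
        intro p
        filter_upwards [eventually_forall_norm_vecMollify_sub_le (hc2 p.1 p.2) isCompact_Icc hεpos hεle hε0 hη]
          with n hn x
        rw [hd2, norm_sub_rev]
        exact hn t htI x
      filter_upwards [eventually_all.2 hall] with n hn i j x using hn (i, j) x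
    -- (2)–(4)
    have l2 : Tendsto (fun n => ∫ x, ⟪w t x, FunctionSpaces.Torus.convect (b t) (Ψn n t) x⟫_ℝ) atTop
        (𝓝 (∫ x, ⟪w t x, FunctionSpaces.Torus.convect (b t) (Φ t) x⟫_ℝ)) := by
      refine tendsto_of_forall_eventually_abs_sub_le
        (C := Fintype.card d * (Fintype.card d : ℝ) * ∫ x, ‖b t x‖ * ‖w t x‖)
        (mul_nonneg (by positivity) (integral_nonneg fun x => mul_nonneg (norm_nonneg _) (norm_nonneg _)))
        fun η hη => ?_
      filter_upwards [hU1 η hη] with n hn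
      rw [abs_sub_comm]
      refine (abs_integral_inner_convect_sub_le_of_partialDeriv_le (hs t) ((hadm n).isSmooth_slice t) hn
        hτ.2.1 hbwt).trans (le_of_eq ?_)
      ring
    have l3 : Tendsto (fun n => ∫ x, ⟪w t x, viscAdj 𝔸 (Ψn n t) x⟫_ℝ) atTop
        (𝓝 (∫ x, ⟪w t x, viscAdj 𝔸 (Φ t) x⟫_ℝ)) := by
      refine tendsto_of_forall_eventually_abs_sub_le
        (C := K𝔸 * (Fintype.card d : ℝ) * ∫ x, ‖w t x‖)
        (mul_nonneg (mul_nonneg hK0 (Nat.cast_nonneg _)) (integral_nonneg fun x => norm_nonneg _)) fun η hη => ?_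
      filter_upwards [hU2 η hη] with n hn
      rw [abs_sub_comm]
      refine (abs_integral_inner_viscAdj_sub_le_of_partialDeriv₂_le 𝔸 (hs t) ((hadm n).isSmooth_slice t) hn
        hτ.1).trans (le_of_eq ?_)
      rw [hK𝔸]; ring
    have l4 : Tendsto (fun n => ∫ x, ⟪b t x, FunctionSpaces.Torus.convect (w t) (Ψn n t) x⟫_ℝ) atTop
        (𝓝 (∫ x, ⟪b t x, FunctionSpaces.Torus.convect (w t) (Φ t) x⟫_ℝ)) := by
      have hwb : Integrable (fun x => ‖w t x‖ * ‖b t x‖) volume := hbwt.congr (ae_of_all _ fun x => mul_comm _ _)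
      refine tendsto_of_forall_eventually_abs_sub_le
        (C := Fintype.card d * (Fintype.card d : ℝ) * ∫ x, ‖w t x‖ * ‖b t x‖)
        (mul_nonneg (by positivity) (integral_nonneg fun x => mul_nonneg (norm_nonneg _) (norm_nonneg _)))
        fun η hη => ?_
      filter_upwards [hU1 η hη] with n hn
      rw [abs_sub_comm]
      refine (abs_integral_inner_convect_sub_le_of_partialDeriv_le (hs t) ((hadm n).isSmooth_slice t) hn
        hτ.2.2 hwb).trans (le_of_eq ?_)
      ring
    rw [hGdef]
    exact l1.add (l2.add (l3.add (l4.const_mul A)))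
  -- dominated convergence in `t`
  have hDCT := tendsto_integral_of_dominated_convergence bound hGN_meas hbound_int h_le h_lim
  -- the identities for the mollified tests, in terms of `GN`
  have heqN : ∀ n, ∫ t in Ioo 0 T, GN n t = -∫ x, ⟪w₀ x, Ψn n 0 x⟫_ℝ := by
    intro n
    have hae : ∀ᵐ t ∂(volume.restrict (Ioo 0 T)),
        (∫ x, (⟪w t x, FunctionSpaces.Torus.timeDeriv (Ψn n) t x + FunctionSpaces.Torus.convect (b t) (Ψn n t) x +
          viscAdj 𝔸 (Ψn n t) x⟫_ℝ + A * ⟪b t x, FunctionSpaces.Torus.convect (w t) (Ψn n t) x⟫_ℝ)) = GN n t := by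
      filter_upwards [hsl] with t hslt
      exact hsplit (hslt n).1 (hslt n).2.1 (hslt n).2.2.1 (hslt n).2.2.2
    have h1 := hI n
    rw [integral_congr_ae hae] at h1
    linarith
  -- the datum term
  have hdatum : Tendsto (fun n => -∫ x, ⟪w₀ x, Ψn n 0 x⟫_ℝ) atTop (𝓝 (-∫ x, ⟪w₀ x, Φ 0 x⟫_ℝ)) := by
    refine (tendsto_of_forall_eventually_abs_sub_le (C := Fintype.card d * ∫ x, ‖w₀ x‖)
      (mul_nonneg (Nat.cast_nonneg _) (integral_nonneg fun x => norm_nonneg _)) fun η hη => ?_).neg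
    filter_upwards [eventually_forall_norm_vecMollify_sub_le hc isCompact_singleton hεpos hεle hε0 hη] with n hn
    have i0 : Integrable (fun x => ⟪w₀ x, Ψn n 0 x⟫_ℝ) volume :=
      FunctionSpaces.Torus.integrable_inner_of_continuous hw₀i ((hadm n).isSmooth_slice 0).continuous
    have i0' : Integrable (fun x => ⟪w₀ x, Φ 0 x⟫_ℝ) volume :=
      FunctionSpaces.Torus.integrable_inner_of_continuous hw₀i (hs 0).continuous
    rw [← integral_sub i0 i0', ← Real.norm_eq_abs]
    calc ‖∫ x, (⟪w₀ x, Ψn n 0 x⟫_ℝ - ⟪w₀ x, Φ 0 x⟫_ℝ)‖ ≤ ∫ x, ‖w₀ x‖ * (Fintype.card d * η) := by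
          refine norm_integral_le_of_norm_le (hw₀i.norm.mul_const _) (ae_of_all _ fun x => ?_)
          rw [← inner_sub_right, Real.norm_eq_abs]
          exact (abs_real_inner_le_norm _ _).trans (mul_le_mul_of_nonneg_left (hn 0 (mem_singleton 0) x) (norm_nonneg _))
      _ = Fintype.card d * (∫ x, ‖w₀ x‖) * η := by rw [integral_mul_const]; ring
  have hlim_eq : ∫ t in Ioo 0 T, G t = -∫ x, ⟪w₀ x, Φ 0 x⟫_ℝ := by
    have h1 : Tendsto (fun n => ∫ t in Ioo 0 T, GN n t) atTop (𝓝 (-∫ x, ⟪w₀ x, Φ 0 x⟫_ℝ)) := by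
      simp_rw [heqN]; exact hdatum
    exact tendsto_nhds_unique hDCT h1
  -- identify the weak-form integrand with `G`
  have hae : ∀ᵐ t ∂(volume.restrict (Ioo 0 T)),
      (∫ x, (⟪w t x, FunctionSpaces.Torus.timeDeriv Φ t x + FunctionSpaces.Torus.convect (b t) (Φ t) x +
          viscAdj 𝔸 (Φ t) x⟫_ℝ + A * ⟪b t x, FunctionSpaces.Torus.convect (w t) (Φ t) x⟫_ℝ)) = G t := by
    filter_upwards [hslΦ] with t hslΦt
    exact hsplit hslΦt.1 hslΦt.2.1 hslΦt.2.2.1 hslΦt.2.2.2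
  rw [integral_congr_ae hae, hlim_eq]
  ring

end IsWeakTensorPassiveVectorOn

end Main

end Torus

end Literature.Analysis.FluidPDE
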